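import Summits.QuantumFields.BalabanUV.Beta.GAN24.AlmostNestedWordRate
import Summits.QuantumFields.BalabanUV.Beta.GAN24.NestedBlockIndicatorLegs

/-!
# `BalabanUV.Beta.GAN24.AlmostNestedLoopEnd` — binder row G-an2-4 ∕ (CONV-C), routes C-R6° («VALUES») × R7 («TWO CURRENCIES»), PART 229:
# CENSUS V204′ (ii) — V196's ONE-LOOP CONTRACTION `Γ_k(Y_k ⊗ₖ Y_k)Γ_kᴴ` HAS THE WHOLE `LimitRate` END FOR EVERY BOUNDED, ALMOST NESTED, LOCALISED SINGLE-DIRECTION FAMILY WITH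
# POINTWISE LIMITS, AT THE STEP RATIO `L^{−1∕4}` — NO Lipschitz letter, NO nesting: the finer profile's block averages agree with the coarser profile off a union of coordinate
# slabs of at most `m` fine layers (PART 213's `ρ ≤ 0` balls; half blocks; every NESTED family with `m = 0`).  §1 is PART 197 §4 at ANY step ratio `θ ∈ [√(L⁻¹), 1)`
# (unit b2b-balaban-gan24-p3, gen 64; v1)

NOT IN PRINT; OUR PROOF ([folklore] bookkeeping BY NAME over PART 228 (`towerLimitRate_almostNestedWord`), PART 197 (`conv_oneLoop_of_inputs_moving`, verbatim §4 with
`twoLevelDecayRate_of_le_ratio`), PART 195 (`exists_loopCov_inputs`), PART 198 (`exists_twoPoint_insertion`), PART 213 (`boundedLegs_tendsto`), `decayRate_of_towerLimitRate`;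
[Balaban1987RG1] (1.20)–(1.22) p. 264 LOCATE the one-loop shape; nothing printed is a hypothesis).
HONEST FRAMING (cell contract, verbatim): «discharging `BetaPertH` makes Bałaban's UV stability UNCONDITIONAL — a real constructive-QFT result; it is NOT the
continuum limit and NOT the Clay problem.»  HONEST DEPENDENCY (verbatim): «continuum YM on T⁴ ⇐ BetaPertH ∧ nine spine estimates (0/9 proved); BetaPertH ⇐
(D1) ∧ (D4) ∧ CAP+tail; G-an2-4 gates asym, D1 and NE2/3/4.»

WHAT THIS FILE PROVES (0 sorry, 0 `def`; `M_t = fine (Lb·1) (cubic (d+1) (s t))`, `X_{t,x,k}` the insertion word, `Γ_{t,k}(x,(q,r)) = X_{t,x,k}(q,r)`, `Y = c⁻¹𝒢̃c⁻¹`):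
* §1 **`conv_oneLoop_loopCov_moving_of_ratio`** — PART 197 §4 (the `ℤ^{d+1}` END of `Γ_{1,k}(Y_k ⊗ₖ Y_k)Γ_{2,k}ᴴ` modulo the legs) for legs whose step envelope decays like `θ^k`,
  ANY `θ` with `√(L⁻¹) ≤ θ < 1`; conclusion at ratio `θ`.
* §2 **`exists_twoPoint_insertion_rate_almostNestedDir`** (PART 228 §4 with the direction quantified inside, constant `max C 0`), **`almostNestedLegs_envelopes`** (PART 200 §1's
  shape at ratio `√(√(L⁻¹))`, every coarse volume family).
* §3 **`conv_oneLoop_loopCov_almostNestedLegs`** — THE END (`IsInfiniteVolumeLimit (Lb·1·2(t+1))`, `UniformDecay`, `StepRate √(√(L⁻¹))`, `KernelInputs`, second moments) for every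
  bounded, almost nested, localised single-direction family with pointwise limits (`d + 1 ≥ 3`, `L ≥ 2`, every `Lb ≥ 1`, `a > 0`, `μ ≠ ν`).
WHAT IT DOES NOT DO: the five second-order traces for almost nested families (generic-ratio sockets + the two-insertion defect law: next); the defect geometry of the `ρ ≤ 0`
balls (next).  SUPPLIER work; NEVER «G-an2-4 closed»; NOT (CONV-C), NOT D1, NOT `BetaPertH`, NOT continuum, NOT Clay.  Records: `HOME/b2b-balaban-gan24-p3/gen64/README.md`.
-/

noncomputable section

open scoped BigOperators ComplexConjugate Matrix Matrix.Norms.L2Operator Kronecker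
open Filter Topology Finset Matrix

namespace Summit.QuantumFields.BalabanUV.Beta.GAN24.AlmostNestedLoopEnd

open Literature.MathematicalPhysics.QuantumFieldTheory.Balaban1983to89
open Literature.MathematicalPhysics.QuantumFieldTheory.Balaban1983to89.B5Prop11Plancherel (Tor fine Cst Cst_nonneg)
open Literature.MathematicalPhysics.QuantumFieldTheory.Balaban1983to89.B5RealFields (reM)
open Literature.MathematicalPhysics.QuantumFieldTheory.Balaban1983to89.B5G183RateTorusW (CQL)
open Literature.MathematicalPhysics.QuantumFieldTheory.Balaban1983to89.B5G183RateUnitTower (lev)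
open Literature.MathematicalPhysics.QuantumFieldTheory.Balaban1983to89.B12Sec2to5 (betaPrime510)
open Literature.MathematicalPhysics.QuantumFieldTheory.Balaban1983to89.Beta (IsInfiniteVolumeLimit)
open Literature.MathematicalPhysics.QuantumFieldTheory.Balaban1983to89.Beta.FreeLegDictionary (cubic)
open Literature.MathematicalPhysics.QuantumFieldTheory.Balaban1983to89.Beta.BlockKernelVolumeSockets (evenPeriod tendsto_evenPeriod)
open Literature.MathematicalPhysics.QuantumFieldTheory.Balaban1983to89.Beta.VectorTails (castT)
open Literature.MathematicalPhysics.QuantumFieldTheory.Balaban1983to89.Beta.LimitRate (StepRate limKernelOf KernelInputs)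
open Literature.MathematicalPhysics.QuantumFieldTheory.Balaban1983to89.Beta.CompositionSingular (flucCov)
open Literature.MathematicalPhysics.QuantumFieldTheory.Balaban1983to89.Beta.BlockEffectiveAction (DelK)
open Summit.QuantumFields.BalabanUV.T4Continuum.BalabanLineAverage (QB)
open Summit.QuantumFields.BalabanUV.T4Continuum.BalabanAveragedTowerModes (par rem)
open Summit.QuantumFields.BalabanUV.T4Continuum.CovariantAveragingTower (avgTow TowerLimitRate)
open Summit.QuantumFields.BalabanUV.T4Continuum.BalabanAveragedTowerUnit (idx QBlev calGlev unitCovB one_le_lev')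
open Summit.QuantumFields.BalabanUV.T4Continuum.BalabanAveragedCoerciveTower (unitIdx)
open Summit.QuantumFields.BalabanUV.T4Continuum.KingPairingPlantedLaw (CJ CJ_nonneg)
open Summit.QuantumFields.BalabanUV.T4Continuum.BlockPairingGeometry (parT)
open Summit.QuantumFields.BalabanUV.T4Continuum.CTKingTowerWeights (rho distK distK_comm)
open Summit.QuantumFields.BalabanUV.T4Continuum.FirstOrderBackgroundModel (Pmodel)
open Summit.QuantumFields.BalabanUV.T4Continuum.DecayRateInterpolation (EntryDecay TwoLevelDecayRate decayRate_of_towerLimitRate)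
open Summit.QuantumFields.BalabanUV.Beta.GAN24.DiagramDecayAlgebra (twoLevelDecayRate_const_nonneg twoLevelDecayRate_of_le_rate)
open Summit.QuantumFields.BalabanUV.Beta.GAN24.EffectiveFormDecay (entryDecay_of_le_rate)
open Summit.QuantumFields.BalabanUV.Beta.GAN24.UnitLatticeDecayAlgebra (distK_nonneg)
open Summit.QuantumFields.BalabanUV.Beta.GAN24.OneStepLoopCovarianceInputTriple (exists_loopCov_inputs twoLevelDecayRate_of_le_ratio)
open Summit.QuantumFields.BalabanUV.Beta.GAN24.OneStepLoopContractionMovingLegs (conv_oneLoop_of_inputs_moving)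
open Summit.QuantumFields.BalabanUV.Beta.GAN24.InsertionWordTwoPointDecay (exists_twoPoint_insertion)
open Summit.QuantumFields.BalabanUV.Beta.GAN24.BoundedBackgroundLegs (boundedLegs_tendsto)
open Summit.QuantumFields.BalabanUV.Beta.GAN24.AlmostNestedWordRate (towerLimitRate_almostNestedWord)

variable {d : ℕ} (L : ℕ) [NeZero L]

/-! ## §1 PART 197 §4 at any step ratio `θ ∈ [√(L⁻¹), 1)` -/

section LoopCov

variable (Lb : ℕ) [NeZero Lb] (a : ℝ) (ha : 0 < a) (s : ℕ → ℕ) [hs0 : ∀ t, NeZero (s t)]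

/-- **`conv_oneLoop_loopCov_moving_of_ratio` — PART 197 §4 AT ANY STEP RATIO `θ ∈ [√(L⁻¹), 1)`** [our proof]: the one-loop contraction `Γ_{1,k}(Y_k ⊗ₖ Y_k)Γ_{2,k}ᴴ` of the
gauge-fixed loop covariance `Y = c⁻¹𝒢c⁻¹` with moving legs whose STEP envelope decays like `γᵢ′θ^k` has the whole `LimitRate` END at ratio `θ` (the loop covariance's own (SR) at
ratio `√(L⁻¹)` is one at every larger ratio, `twoLevelDecayRate_of_le_ratio`); verbatim PART 197 §4 otherwise.  Needed by almost nested legs (ratio `L^{−1∕4}`).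
[cite: Balaban1987RG1, (1.20)–(1.22) p.264 (shapes)] -/
theorem conv_oneLoop_loopCov_moving_of_ratio (hL : 2 ≤ L) (hd : 1 ≤ d) (hs : Tendsto s atTop atTop) {a' : ℝ} (ha' : 0 < a') {μ ν : Fin (d + 1)} (hne : μ ≠ ν)
    {κΓ : ℝ} (hκΓ : 0 < κΓ) {θ : ℝ} (hθL : Real.sqrt ((L : ℝ)⁻¹) ≤ θ) (hθ1 : θ < 1) :
    ∃ κ₁ C C' : ℝ, 0 < κ₁ ∧ κ₁ ≤ κΓ ∧ 0 ≤ C ∧ 0 ≤ C' ∧ ∀ (γ₁ γ₂ γ₁' γ₂' : ℝ), 0 ≤ γ₁ → 0 ≤ γ₂ → 0 ≤ γ₁' → 0 ≤ γ₂' →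
      ∀ (Γ₁ Γ₂ : (t k : ℕ) → Matrix (idx L (fine (Lb * 1) (cubic (d + 1) (s t))) 0) (idx L (fine (Lb * 1) (cubic (d + 1) (s t))) 0 × idx L (fine (Lb * 1) (cubic (d + 1) (s t))) 0) ℂ),
      (∀ t k x q, ‖Γ₁ t k x q‖ ≤ γ₁ * Real.exp (-(κΓ * (distK L (fine (Lb * 1) (cubic (d + 1) (s t))) x q.1 + distK L (fine (Lb * 1) (cubic (d + 1) (s t))) x q.2)))) →
      (∀ t k x q, ‖Γ₂ t k x q‖ ≤ γ₂ * Real.exp (-(κΓ * (distK L (fine (Lb * 1) (cubic (d + 1) (s t))) x q.1 + distK L (fine (Lb * 1) (cubic (d + 1) (s t))) x q.2)))) →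
      (∀ t k x q, ‖(Γ₁ t (k + 1) - Γ₁ t k) x q‖ ≤ γ₁' * θ ^ k * Real.exp (-(κΓ * (distK L (fine (Lb * 1) (cubic (d + 1) (s t))) x q.1 + distK L (fine (Lb * 1) (cubic (d + 1) (s t))) x q.2)))) →
      (∀ t k x q, ‖(Γ₂ t (k + 1) - Γ₂ t k) x q‖ ≤ γ₂' * θ ^ k * Real.exp (-(κΓ * (distK L (fine (Lb * 1) (cubic (d + 1) (s t))) x q.1 + distK L (fine (Lb * 1) (cubic (d + 1) (s t))) x q.2)))) →
      (∀ k (μ' l l' : Fin (d + 1)) (z u v : Fin (d + 1) → ℤ), ∃ s' : ℂ, Tendsto (fun t => Γ₁ t k ((unitIdx L (fine (Lb * 1) (cubic (d + 1) (s t)))).symm (castT (fine (Lb * 1) (cubic (d + 1) (s t))) z, μ')) (((unitIdx L (fine (Lb * 1) (cubic (d + 1) (s t)))).symm (castT (fine (Lb * 1) (cubic (d + 1) (s t))) u, l)), ((unitIdx L (fine (Lb * 1) (cubic (d + 1) (s t)))).symm (castT (fine (Lb * 1) (cubic (d + 1) (s t))) v, l')))) atTop (𝓝 s')) →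
      (∀ k (μ' l l' : Fin (d + 1)) (z u v : Fin (d + 1) → ℤ), ∃ s' : ℂ, Tendsto (fun t => Γ₂ t k ((unitIdx L (fine (Lb * 1) (cubic (d + 1) (s t)))).symm (castT (fine (Lb * 1) (cubic (d + 1) (s t))) z, μ')) (((unitIdx L (fine (Lb * 1) (cubic (d + 1) (s t)))).symm (castT (fine (Lb * 1) (cubic (d + 1) (s t))) u, l)), ((unitIdx L (fine (Lb * 1) (cubic (d + 1) (s t)))).symm (castT (fine (Lb * 1) (cubic (d + 1) (s t))) v, l')))) atTop (𝓝 s')) →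
      ∃ Pinf : ℕ → B12Beta.Kernel (d + 1),
        (∀ k, IsInfiniteVolumeLimit (fun t => Lb * 1 * s t)
          (fun t μ' ν' (z : Beta.Site (d + 1) (Lb * 1 * s t)) => ((Γ₁ t k * (((unitCovB L (fine (Lb * 1) (cubic (d + 1) (s t))) a ha k)⁻¹ * (((flucCov (reM (DelK (lev L k) (one_le_lev' L k) (fine (Lb * 1) (cubic (d + 1) (s t))) a ha)) (Matrix.fromRows (reM (QB 1 Lb (cubic (d + 1) (s t)))) (fun (t' : {x : Tor (fine (Lb * 1) (cubic (d + 1) (s t))) × Fin (d + 1) // (∀ ν, ν < x.2 → ((rem 1 Lb (cubic (d + 1) (s t)) x.1 ν : ℕ)) = 0) ∧ ((rem 1 Lb (cubic (d + 1) (s t)) x.1 x.2 : ℕ)) + 1 < Lb}) (x : Tor (fine (Lb * 1) (cubic (d + 1) (s t))) × Fin (d + 1)) => if x = (Function.Embedding.subtype (fun x : Tor (fine (Lb * 1) (cubic (d + 1) (s t))) × Fin (d + 1) => (∀ ν, ν < x.2 → ((rem 1 Lb (cubic (d + 1) (s t)) x.1 ν : ℕ)) = 0) ∧ ((rem 1 Lb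 (cubic (d + 1) (s t)) x.1 x.2 : ℕ)) + 1 < Lb)) t' then (1 : ℝ) else 0))).map ((↑) : ℝ → ℂ)).submatrix (unitIdx L (fine (Lb * 1) (cubic (d + 1) (s t)))) (unitIdx L (fine (Lb * 1) (cubic (d + 1) (s t))))) * (unitCovB L (fine (Lb * 1) (cubic (d + 1) (s t))) a ha k)⁻¹) ⊗ₖ ((unitCovB L (fine (Lb * 1) (cubic (d + 1) (s t))) a ha k)⁻¹ * (((flucCov (reM (DelK (lev L k) (one_le_lev' L k) (fine (Lb * 1) (cubic (d + 1) (s t))) a ha)) (Matrix.fromRows (reM (QB 1 Lb (cubic (d + 1) (s t)))) (fun (t' : {x : Tor (fine (Lb * 1) (cubic (d + 1) (s t))) × Fin (d + 1) // (∀ ν, ν < x.2 → ((rem 1 Lb (cubic (d + 1) (s t)) x.1 ν : ℕ)) = 0) ∧ ((rem 1 Lb (cubic (d + 1) (s t)) x.1 x.2 : ℕ)) + 1 < Lb}) (x : Tor (fine (Lb * 1) (cubic (d + 1) (s t))) × Fin (d + 1)) => if x = (Function.Embedding.subtype (fun x : Tor (fine (Lb * 1) (cubic (d + 1) (s t)))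 × Fin (d + 1) => (∀ ν, ν < x.2 → ((rem 1 Lb (cubic (d + 1) (s t)) x.1 ν : ℕ)) = 0) ∧ ((rem 1 Lb (cubic (d + 1) (s t)) x.1 x.2 : ℕ)) + 1 < Lb)) t' then (1 : ℝ) else 0))).map ((↑) : ℝ → ℂ)).submatrix (unitIdx L (fine (Lb * 1) (cubic (d + 1) (s t)))) (unitIdx L (fine (Lb * 1) (cubic (d + 1) (s t))))) * (unitCovB L (fine (Lb * 1) (cubic (d + 1) (s t))) a ha k)⁻¹)) * (Γ₂ t k)ᴴ) ((unitIdx L (fine (Lb * 1) (cubic (d + 1) (s t)))).symm (z, μ')) ((unitIdx L (fine (Lb * 1) (cubic (d + 1) (s t)))).symm (0, ν'))).re) (Pinf k)) ∧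
        Beta.LimitRate.UniformDecay Pinf μ ν (γ₁ * γ₂ * C) ((κ₁ / 4) / (((d + 1 : ℕ)) : ℝ)) ∧
        StepRate Pinf μ ν (((γ₁' * γ₂ + γ₁ * γ₂') * C + γ₁ * γ₂ * C')) ((κ₁ / 4) / (((d + 1 : ℕ)) : ℝ)) (θ) ∧
        (∃ K : KernelInputs (d + 1) Pinf, K.θ = θ ∧ K.c₀ = betaPrime510 (d + 1) ((((γ₁' * γ₂ + γ₁ * γ₂') * C + γ₁ * γ₂ * C')) / (1 - θ)) ((κ₁ / 4) / (((d + 1 : ℕ)) : ℝ)) ∧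
          K.Pinf = limKernelOf Pinf ∧ K.μ = μ ∧ K.ν = ν) ∧
        (∀ k, |B12Beta.secondMoment (Pinf k) μ ν - B12Beta.secondMoment (limKernelOf Pinf) μ ν|
            ≤ betaPrime510 (d + 1) ((((γ₁' * γ₂ + γ₁ * γ₂') * C + γ₁ * γ₂ * C')) / (1 - θ)) ((κ₁ / 4) / (((d + 1 : ℕ)) : ℝ)) * θ ^ k) := by
  have hd' : 2 ≤ d + 1 := by omega
  have hL1 : (1 : ℝ) < L := by exact_mod_cast (lt_of_lt_of_le one_lt_two hL : 1 < L)
  have hθ0' : 0 ≤ Real.sqrt ((L : ℝ)⁻¹) := Real.sqrt_nonneg _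
  have hθ0 : 0 ≤ θ := hθ0'.trans hθL
  have hside : Tendsto (fun t => Lb * 1 * s t) atTop atTop :=
    Filter.tendsto_atTop_mono (fun t => Nat.le_mul_of_pos_left _ (Nat.pos_of_ne_zero (NeZero.ne (Lb * 1)))) hs
  obtain ⟨κ₀, B, B', hκ₀, hB, hud, hsr, hel⟩ := exists_loopCov_inputs L a ha Lb s hL hd hs ha'
  have hB' : 0 ≤ B' := by
    haveI : Nonempty (idx L (fine (Lb * 1) (cubic (d + 1) (s 0))) 0) := ⟨(unitIdx L _).symm (0, μ)⟩
    exact twoLevelDecayRate_const_nonneg (hsr 0)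
  have hκ₁ : 0 < min κ₀ κΓ := lt_min hκ₀ hκΓ
  have hud₁ : ∀ t k, EntryDecay (distK L (fine (Lb * 1) (cubic (d + 1) (s t)))) (((unitCovB L (fine (Lb * 1) (cubic (d + 1) (s t))) a ha k)⁻¹ * (((flucCov (reM (DelK (lev L k) (one_le_lev' L k) (fine (Lb * 1) (cubic (d + 1) (s t))) a ha)) (Matrix.fromRows (reM (QB 1 Lb (cubic (d + 1) (s t)))) (fun (t' : {x : Tor (fine (Lb * 1) (cubic (d + 1) (s t))) × Fin (d + 1) // (∀ ν, ν < x.2 → ((rem 1 Lb (cubic (d + 1) (s t)) x.1 ν : ℕ)) = 0) ∧ ((rem 1 Lb (cubic (d + 1) (s t)) x.1 x.2 : ℕ)) + 1 < Lb}) (x : Tor (fine (Lb * 1) (cubic (d + 1) (s t))) × Fin (d + 1)) => if x = (Function.Embedding.subtype (fun x : Tor (fine (Lb * 1) (cubic (d + 1) (s t))) × Fin (d + 1) => (∀ ν, ν < x.2 → ((rem 1 Lb (cubic (d + 1) (s t)) x.1 ν : ℕ)) = 0) ∧ ((rem 1 Lb (cubic (d + 1) (s t)) x.1 x.2 : ℕ))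 + 1 < Lb)) t' then (1 : ℝ) else 0))).map ((↑) : ℝ → ℂ)).submatrix (unitIdx L (fine (Lb * 1) (cubic (d + 1) (s t)))) (unitIdx L (fine (Lb * 1) (cubic (d + 1) (s t))))) * (unitCovB L (fine (Lb * 1) (cubic (d + 1) (s t))) a ha k)⁻¹)) B (min κ₀ κΓ) :=
    fun t k => entryDecay_of_le_rate (distK_nonneg L _) (hud t k) hB (min_le_left _ _)
  have hsr₁ : ∀ t, TwoLevelDecayRate (distK L (fine (Lb * 1) (cubic (d + 1) (s t)))) (fun k => ((unitCovB L (fine (Lb * 1) (cubic (d + 1) (s t))) a ha k)⁻¹ * (((flucCov (reM (DelK (lev L k) (one_le_lev' L k) (fine (Lb * 1) (cubic (d + 1) (s t))) a ha)) (Matrix.fromRows (reM (QB 1 Lb (cubic (d + 1) (s t)))) (fun (t' : {x : Tor (fine (Lb * 1) (cubic (d + 1) (s t))) × Fin (d + 1) // (∀ ν, ν < x.2 → ((rem 1 Lb (cubic (d + 1) (s t)) x.1 ν : ℕ)) = 0) ∧ ((rem 1 Lb (cubic (d + 1) (s t)) x.1 x.2 : ℕ)) + 1 < Lb}) (x : Tor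 (fine (Lb * 1) (cubic (d + 1) (s t))) × Fin (d + 1)) => if x = (Function.Embedding.subtype (fun x : Tor (fine (Lb * 1) (cubic (d + 1) (s t))) × Fin (d + 1) => (∀ ν, ν < x.2 → ((rem 1 Lb (cubic (d + 1) (s t)) x.1 ν : ℕ)) = 0) ∧ ((rem 1 Lb (cubic (d + 1) (s t)) x.1 x.2 : ℕ)) + 1 < Lb)) t' then (1 : ℝ) else 0))).map ((↑) : ℝ → ℂ)).submatrix (unitIdx L (fine (Lb * 1) (cubic (d + 1) (s t)))) (unitIdx L (fine (Lb * 1) (cubic (d + 1) (s t))))) * (unitCovB L (fine (Lb * 1) (cubic (d + 1) (s t))) a ha k)⁻¹)) B' (min κ₀ κΓ) (θ) :=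
    fun t => twoLevelDecayRate_of_le_ratio (twoLevelDecayRate_of_le_rate (distK_nonneg L _) (hsr t) hB' hθ0' (min_le_left _ _)) hB' hθ0' hθL
  -- an envelope at rate `κ_Γ` is one at rate `min κ₀ κ_Γ` (level and step envelopes alike: the prefactor is `≥ 0`)
  have hweak : ∀ {c : ℝ} (G : (t : ℕ) → Matrix (idx L (fine (Lb * 1) (cubic (d + 1) (s t))) 0) (idx L (fine (Lb * 1) (cubic (d + 1) (s t))) 0 × idx L (fine (Lb * 1) (cubic (d + 1) (s t))) 0) ℂ), 0 ≤ c →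
      (∀ t x q, ‖G t x q‖ ≤ c * Real.exp (-(κΓ * (distK L (fine (Lb * 1) (cubic (d + 1) (s t))) x q.1 + distK L (fine (Lb * 1) (cubic (d + 1) (s t))) x q.2)))) →
      ∀ t x q, ‖G t x q‖ ≤ c * Real.exp (-(min κ₀ κΓ * (distK L (fine (Lb * 1) (cubic (d + 1) (s t))) x q.1 + distK L (fine (Lb * 1) (cubic (d + 1) (s t))) x q.2))) := by
    intro c G hc hG t x q
    refine (hG t x q).trans (mul_le_mul_of_nonneg_left (Real.exp_le_exp.mpr ?_) hc)
    have h0 : 0 ≤ distK L (fine (Lb * 1) (cubic (d + 1) (s t))) x q.1 + distK L (fine (Lb * 1) (cubic (d + 1) (s t))) x q.2 := add_nonneg (distK_nonneg L _ _ _) (distK_nonneg L _ _ _)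
    nlinarith [min_le_right κ₀ κΓ]
  obtain ⟨C, C', hC, hC', h⟩ := conv_oneLoop_of_inputs_moving L hd' (side := fun t => Lb * 1 * s t) hside (Y := fun t k => ((unitCovB L (fine (Lb * 1) (cubic (d + 1) (s t))) a ha k)⁻¹ * (((flucCov (reM (DelK (lev L k) (one_le_lev' L k) (fine (Lb * 1) (cubic (d + 1) (s t))) a ha)) (Matrix.fromRows (reM (QB 1 Lb (cubic (d + 1) (s t)))) (fun (t' : {x : Tor (fine (Lb * 1) (cubic (d + 1) (s t))) × Fin (d + 1) // (∀ ν, ν < x.2 → ((rem 1 Lb (cubic (d + 1) (s t)) x.1 ν : ℕ)) = 0) ∧ ((rem 1 Lb (cubic (d + 1) (s t)) x.1 x.2 : ℕ)) + 1 < Lb}) (x : Tor (fine (Lb * 1) (cubic (d + 1) (s t))) × Fin (d + 1)) => if x = (Function.Embedding.subtype (fun x : Tor (fine (Lb * 1) (cubic (d + 1) (s t))) × Fin (d + 1) => (∀ ν, ν < x.2 → ((rem 1 Lb (cubic (d + 1) (s t)) x.1 ν : ℕ)) = 0) ∧ ((rem 1 Lb (cubic (d + 1) (s t)) x.1 x.2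 : ℕ)) + 1 < Lb)) t' then (1 : ℝ) else 0))).map ((↑) : ℝ → ℂ)).submatrix (unitIdx L (fine (Lb * 1) (cubic (d + 1) (s t)))) (unitIdx L (fine (Lb * 1) (cubic (d + 1) (s t))))) * (unitCovB L (fine (Lb * 1) (cubic (d + 1) (s t))) a ha k)⁻¹)) hκ₁ hB hB' hθ0 hθ1 hud₁ hsr₁ hel hne
  refine ⟨min κ₀ κΓ, C, C', hκ₁, min_le_right _ _, hC, hC', fun γ₁ γ₂ γ₁' γ₂' hγ₁ hγ₂ hγ₁' hγ₂' Γ₁ Γ₂ hΓ₁ hΓ₂ hΓ₁' hΓ₂' =>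
    h γ₁ γ₂ γ₁' γ₂' hγ₁ hγ₂ hγ₁' hγ₂' Γ₁ Γ₂ (fun t k => hweak (fun t' => Γ₁ t' k) hγ₁ (fun t' => hΓ₁ t' k) t)
      (fun t k => hweak (fun t' => Γ₂ t' k) hγ₂ (fun t' => hΓ₂ t' k) t)
      (fun t k => hweak (fun t' => Γ₁ t' (k + 1) - Γ₁ t' k) (mul_nonneg hγ₁' (pow_nonneg hθ0 k)) (fun t' => hΓ₁' t' k) t)
      (fun t k => hweak (fun t' => Γ₂ t' (k + 1) - Γ₂ t' k) (mul_nonneg hγ₂' (pow_nonneg hθ0 k)) (fun t' => hΓ₂' t' k) t)⟩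

end LoopCov

/-! ## §2 The two leg envelopes for almost nested bounded single-direction families -/

section Envelopes

variable (a : ℝ) (ha : 0 < a)

/-- **`exists_twoPoint_insertion_rate_almostNestedDir` — PART 228 §4 WITH THE DIRECTION QUANTIFIED INSIDE** (its constants do not depend on `μ₀`): `∃ κ > 0, B, B′ ≥ 0` from
`(d, L, a, α, c₀, m)` such that for EVERY torus, unit bond `i`, direction `μ₀` and every bounded single-direction ALMOST NESTED family (defect off `⋃_ν` slabs `A_{k,ν}`, `#A_{k,ν} ≤ m`)
supported where `ρ_{k,i} ≤ c₀`: the level envelope `B·e^{−κ(…)}` and the step envelope `B′·(√(√(L⁻¹)))^k·e^{−κ(…)}` of the insertion word. [our proof] -/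
theorem exists_twoPoint_insertion_rate_almostNestedDir (hL : 2 ≤ L) (α c₀ : ℝ) (hα : 0 ≤ α) (m : ℕ) :
    ∃ κ B B' : ℝ, 0 < κ ∧ 0 ≤ B ∧ 0 ≤ B' ∧ ∀ (M : Fin d → ℕ) [∀ μ, NeZero (M μ)] (i : idx L M 0) (μ₀ : Fin d) (V : (k : ℕ) → Fin d → (idx L M k → ℂ))
      (A : (k : ℕ) → (ν : Fin d) → Finset (ZMod (fine (lev L k) M ν))),
      (∀ k μ u, ‖V k μ u‖ ≤ α) → (∀ k μ u, μ ≠ μ₀ → V k μ u = 0) → (∀ k ν, (A k ν).card ≤ m) →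
      (∀ k (u : idx L M k), (∀ ν, u.1 ν ∉ A k ν) →
        ((L : ℂ) ^ d)⁻¹ * ∑ x ∈ univ.filter (fun x : idx L M (k + 1) => parT (lev L k) L M x = u), V (k + 1) μ₀ x = V k μ₀ u) →
      (∀ k μ u, V k μ u ≠ 0 → rho L M k i u ≤ c₀) →
      (∀ k x y, ‖avgTow (QBlev L M) ((L : ℝ) ^ d) (fun k => calGlev L M a ha k * Pmodel L M V k * calGlev L M a ha k) k x y‖
        ≤ B * Real.exp (-(κ * (distK L M x i + distK L M y i)))) ∧
      (∀ k x y, ‖(avgTow (QBlev L M) ((L : ℝ) ^ d) (fun k => calGlev L M a ha k * Pmodel L M V k * calGlev L M a ha k) (k + 1)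
          - avgTow (QBlev L M) ((L : ℝ) ^ d) (fun k => calGlev L M a ha k * Pmodel L M V k * calGlev L M a ha k) k) x y‖
        ≤ B' * Real.sqrt (Real.sqrt ((L : ℝ)⁻¹)) ^ k * Real.exp (-(κ * (distK L M x i + distK L M y i)))) := by
  obtain ⟨κ, B, hκ0, hB, hUD⟩ := exists_twoPoint_insertion L a ha α c₀ hα
  set C : ℝ := α * Cst d a * CJ d a + Cst d a * α * (CQL d a + 4 * d * Cst d a) + Cst d a * (d * (Cst d a * Real.sqrt (3 * m)) * (2 * α))
        + α * Cst d a * (d * L * Cst d a) + Cst d a * α * (d * L * Cst d a) with hCdef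
  have hL1 : (1 : ℝ) < L := by exact_mod_cast (lt_of_lt_of_le one_lt_two hL : 1 < L)
  have hρ0 : (0 : ℝ) ≤ (L : ℝ)⁻¹ := inv_nonneg.mpr (Nat.cast_nonneg _)
  have hρ1 : ((L : ℝ)⁻¹) < 1 := inv_lt_one_of_one_lt₀ hL1
  have hσ0 : 0 ≤ Real.sqrt ((L : ℝ)⁻¹) := Real.sqrt_nonneg _
  have hσ1 : Real.sqrt ((L : ℝ)⁻¹) < 1 := by
    rw [show (1 : ℝ) = Real.sqrt 1 from Real.sqrt_one.symm]
    exact Real.sqrt_lt_sqrt hρ0 hρ1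
  refine ⟨κ / 2, B, Real.sqrt (2 * B * (2 * (max C 0) / (1 - Real.sqrt ((L : ℝ)⁻¹)))), half_pos hκ0, hB, Real.sqrt_nonneg _,
    fun M _ i μ₀ V A hVb hdir hA hdef hloc => ?_⟩
  have hT := towerLimitRate_almostNestedWord L M a ha hL hα hVb hdir A hA hdef
  have hC0 : 0 ≤ max C 0 := le_max_right _ _
  have hT' : TowerLimitRate (QBlev L M) ((L : ℝ) ^ d) (fun k => calGlev L M a ha k * Pmodel L M V k * calGlev L M a ha k) (max C 0) (Real.sqrt ((L : ℝ)⁻¹)) := by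
    obtain ⟨Xlim, hlim, hrate⟩ := hT
    refine ⟨Xlim, hlim, fun k => (hrate k).trans ?_⟩
    have h1 : 0 < 1 - Real.sqrt ((L : ℝ)⁻¹) := sub_pos.mpr hσ1
    exact div_le_div_of_nonneg_right (mul_le_mul_of_nonneg_right (le_max_left _ _) (pow_nonneg hσ0 k)) h1.le
  have hdec : ∀ k, EntryDecay (fun x y => distK L M x i + distK L M y i)
      (avgTow (QBlev L M) ((L : ℝ) ^ d) (fun k => calGlev L M a ha k * Pmodel L M V k * calGlev L M a ha k) k) B κ :=
    fun k x y => hUD M i V hVb hloc k x y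
  obtain ⟨clim, -, -, -, hstep⟩ := decayRate_of_towerLimitRate hσ0 hσ1 hC0 hT' hdec
  refine ⟨fun k x y => (hUD M i V hVb hloc k x y).trans (mul_le_mul_of_nonneg_left (Real.exp_le_exp.mpr ?_) hB), fun k x y => hstep k x y⟩
  have h0 : 0 ≤ distK L M x i + distK L M y i := add_nonneg (distK_nonneg L M _ _) (distK_nonneg L M _ _)
  nlinarith

variable (Lb : ℕ) [NeZero Lb]

/-- **`almostNestedLegs_envelopes` — THE LEVEL AND STEP ENVELOPES OF THE INSERTION-WORD LEGS OF A BOUNDED ALMOST NESTED SINGLE-DIRECTION FAMILY, EVERY COARSE VOLUME FAMILY**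
[our proof] (`L ≥ 2`, `α ≥ 0`, `m` layers): PART 200 §1's shape with the step ratio `√(√(L⁻¹)) = L^{−1∕4}` — for families `V_{t,x}` bounded by `α`, single direction `x₂`, whose
block averages agree with the coarser profile off `⋃_ν` slabs `A_{t,x,k,ν}` (`#A ≤ m`), supported where `ρ_{k,x} ≤ c₀`; NO Lipschitz letter, NO nesting. -/
theorem almostNestedLegs_envelopes (hL : 2 ≤ L) (α c₀ : ℝ) (hα : 0 ≤ α) (m : ℕ) :
    ∃ κ B B' : ℝ, 0 < κ ∧ 0 ≤ B ∧ 0 ≤ B' ∧ ∀ (s : ℕ → ℕ) [∀ t, NeZero (s t)] (V : (t : ℕ) → idx L (fine (Lb * 1) (cubic (d + 1) (s t))) 0 → (k : ℕ) → Fin (d + 1) → (idx L (fine (Lb * 1) (cubic (d + 1) (s t))) k → ℂ))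
      (A : (t : ℕ) → idx L (fine (Lb * 1) (cubic (d + 1) (s t))) 0 → (k : ℕ) → (ν : Fin (d + 1)) → Finset (ZMod (fine (lev L k) (fine (Lb * 1) (cubic (d + 1) (s t))) ν))),
      (∀ t i k μ u, ‖V t i k μ u‖ ≤ α) → (∀ t (i : idx L (fine (Lb * 1) (cubic (d + 1) (s t))) 0) k μ u, μ ≠ i.2 → V t i k μ u = 0) → (∀ t i k ν, (A t i k ν).card ≤ m) →
      (∀ t (i : idx L (fine (Lb * 1) (cubic (d + 1) (s t))) 0) k (u : idx L (fine (Lb * 1) (cubic (d + 1) (s t))) k), (∀ ν, u.1 ν ∉ A t i k ν) →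
        ((L : ℂ) ^ (d + 1))⁻¹ * ∑ x ∈ univ.filter (fun x : idx L (fine (Lb * 1) (cubic (d + 1) (s t))) (k + 1) => parT (lev L k) L (fine (Lb * 1) (cubic (d + 1) (s t))) x = u), V t i (k + 1) i.2 x = V t i k i.2 u) →
      (∀ t i k μ u, V t i k μ u ≠ 0 → rho L (fine (Lb * 1) (cubic (d + 1) (s t))) k i u ≤ c₀) →
      (∀ t k x q, ‖(Matrix.of fun (x : idx L (fine (Lb * 1) (cubic (d + 1) (s t))) 0) (q : idx L (fine (Lb * 1) (cubic (d + 1) (s t))) 0 × idx L (fine (Lb * 1) (cubic (d + 1) (s t))) 0) => avgTow (QBlev L (fine (Lb * 1) (cubic (d + 1) (s t)))) ((L : ℝ) ^ (d + 1)) (fun k => calGlev L (fine (Lb * 1) (cubic (d + 1) (s t))) a ha k * Pmodel L (fine (Lb * 1) (cubic (d + 1) (s t))) (V t x) k * calGlev L (fine (Lb * 1) (cubic (d + 1) (s t))) a ha k) k q.1 q.2) x q‖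
        ≤ B * Real.exp (-(κ * (distK L (fine (Lb * 1) (cubic (d + 1) (s t))) x q.1 + distK L (fine (Lb * 1) (cubic (d + 1) (s t))) x q.2)))) ∧
      (∀ t k x q, ‖((Matrix.of fun (x : idx L (fine (Lb * 1) (cubic (d + 1) (s t))) 0) (q : idx L (fine (Lb * 1) (cubic (d + 1) (s t))) 0 × idx L (fine (Lb * 1) (cubic (d + 1) (s t))) 0) => avgTow (QBlev L (fine (Lb * 1) (cubic (d + 1) (s t)))) ((L : ℝ) ^ (d + 1)) (fun k => calGlev L (fine (Lb * 1) (cubic (d + 1) (s t))) a ha k * Pmodel L (fine (Lb * 1) (cubic (d + 1) (s t))) (V t x) k * calGlev L (fine (Lb * 1) (cubic (d + 1) (s t))) a ha k) (k + 1) q.1 q.2)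
          - (Matrix.of fun (x : idx L (fine (Lb * 1) (cubic (d + 1) (s t))) 0) (q : idx L (fine (Lb * 1) (cubic (d + 1) (s t))) 0 × idx L (fine (Lb * 1) (cubic (d + 1) (s t))) 0) => avgTow (QBlev L (fine (Lb * 1) (cubic (d + 1) (s t)))) ((L : ℝ) ^ (d + 1)) (fun k => calGlev L (fine (Lb * 1) (cubic (d + 1) (s t))) a ha k * Pmodel L (fine (Lb * 1) (cubic (d + 1) (s t))) (V t x) k * calGlev L (fine (Lb * 1) (cubic (d + 1) (s t))) a ha k) k q.1 q.2)) x q‖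
        ≤ B' * Real.sqrt (Real.sqrt ((L : ℝ)⁻¹)) ^ k * Real.exp (-(κ * (distK L (fine (Lb * 1) (cubic (d + 1) (s t))) x q.1 + distK L (fine (Lb * 1) (cubic (d + 1) (s t))) x q.2)))) := by
  obtain ⟨κ, B, B', hκ, hB, hB', h⟩ := exists_twoPoint_insertion_rate_almostNestedDir L a ha (d := d + 1) hL α c₀ hα m
  refine ⟨κ, B, B', hκ, hB, hB', fun s _ V A hVb hdir hA hdef hloc => ⟨fun t k x q => ?_, fun t k x q => ?_⟩⟩
  · rw [Matrix.of_apply, distK_comm L _ x q.1, distK_comm L _ x q.2]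
    exact (h (fine (Lb * 1) (cubic (d + 1) (s t))) x x.2 (V t x) (A t x) (hVb t x) (hdir t x) (hA t x) (hdef t x) (hloc t x)).1 k q.1 q.2
  · rw [Matrix.sub_apply, Matrix.of_apply, Matrix.of_apply, ← Matrix.sub_apply, distK_comm L _ x q.1, distK_comm L _ x q.2]
    exact (h (fine (Lb * 1) (cubic (d + 1) (s t))) x x.2 (V t x) (A t x) (hVb t x) (hdir t x) (hA t x) (hdef t x) (hloc t x)).2 k q.1 q.2

end Envelopes

/-! ## §3 V196's one-loop contraction END for almost nested bounded families -/

variable (Lb : ℕ) [NeZero Lb] (a : ℝ) (ha : 0 < a)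

/-- **`conv_oneLoop_loopCov_almostNestedLegs` — V196's ONE-LOOP CONTRACTION END FOR EVERY BOUNDED, ALMOST NESTED, LOCALISED SINGLE-DIRECTION FAMILY WITH POINTWISE LIMITS**
[our proof] (`d + 1 ≥ 3`, `L ≥ 2`, every `Lb ≥ 1`, `a > 0`, `μ ≠ ν`, coarse volumes `2(t+1)`; NO Lipschitz letter, NO nesting — the block averages of `V_{t,i}^{(k+1)}` agree with
`V_{t,i}^{(k)}` off `⋃_ν` slabs of at most `m` fine layers): `Γ_{t,k}(Y_{t,k} ⊗ₖ Y_{t,k})Γ_{t,k}ᴴ` has the whole `LimitRate` END on `ℤ^{d+1}` at the step ratio `√(√(L⁻¹)) = L^{−1∕4}`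
— §1 fed with §2's envelopes and PART 213 §3's EL₃ (`boundedLegs_tendsto`).  Census V204′ (ii). [cite: Balaban1987RG1, (1.20)–(1.22) p.264 (shapes)] -/
theorem conv_oneLoop_loopCov_almostNestedLegs (hL : 2 ≤ L) (hd : 2 ≤ d) {μ ν : Fin (d + 1)} (hne : μ ≠ ν) {α c₀ : ℝ} (hα : 0 ≤ α) {m : ℕ}
    {V : (t : ℕ) → idx L (fine (Lb * 1) (cubic (d + 1) (evenPeriod t))) 0 → (k : ℕ) → Fin (d + 1) → (idx L (fine (Lb * 1) (cubic (d + 1) (evenPeriod t))) k → ℂ)}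
    (hVb : ∀ t i k μ u, ‖V t i k μ u‖ ≤ α)
    (hdir : ∀ t (i : idx L (fine (Lb * 1) (cubic (d + 1) (evenPeriod t))) 0) k μ u, μ ≠ i.2 → V t i k μ u = 0)
    (A : (t : ℕ) → idx L (fine (Lb * 1) (cubic (d + 1) (evenPeriod t))) 0 → (k : ℕ) → (ν : Fin (d + 1)) → Finset (ZMod (fine (lev L k) (fine (Lb * 1) (cubic (d + 1) (evenPeriod t))) ν))) (hA : ∀ t i k ν, (A t i k ν).card ≤ m)
    (hdef : ∀ t (i : idx L (fine (Lb * 1) (cubic (d + 1) (evenPeriod t))) 0) k (u : idx L (fine (Lb * 1) (cubic (d + 1) (evenPeriod t))) k), (∀ ν, u.1 ν ∉ A t i k ν) →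
      ((L : ℂ) ^ (d + 1))⁻¹ * ∑ x ∈ univ.filter (fun x : idx L (fine (Lb * 1) (cubic (d + 1) (evenPeriod t))) (k + 1) => parT (lev L k) L (fine (Lb * 1) (cubic (d + 1) (evenPeriod t))) x = u), V t i (k + 1) i.2 x = V t i k i.2 u)
    (hloc : ∀ t i k μ u, V t i k μ u ≠ 0 → rho L (fine (Lb * 1) (cubic (d + 1) (evenPeriod t))) k i u ≤ c₀)
    (hel : ∀ (z : Fin (d + 1) → ℤ) (μ' : Fin (d + 1)) (k : ℕ) (μ f : Fin (d + 1)) (w : Fin (d + 1) → ℤ), ∃ s : ℂ,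
      Tendsto (fun t => V t ((unitIdx L (fine (Lb * 1) (cubic (d + 1) (evenPeriod t)))).symm (castT (fine (Lb * 1) (cubic (d + 1) (evenPeriod t))) z, μ')) k μ (castT (fine (lev L k) (fine (Lb * 1) (cubic (d + 1) (evenPeriod t)))) w, f)) atTop (𝓝 s)) :
    ∃ κ₁ C C' : ℝ, 0 < κ₁ ∧ 0 ≤ C ∧ 0 ≤ C' ∧ ∃ Pinf : ℕ → B12Beta.Kernel (d + 1),
      (∀ k, IsInfiniteVolumeLimit (fun t => Lb * 1 * evenPeriod t)
        (fun t μ' ν' (z : Beta.Site (d + 1) (Lb * 1 * evenPeriod t)) => (((Matrix.of fun (x : idx L (fine (Lb * 1) (cubic (d + 1) (evenPeriod t))) 0) (q : idx L (fine (Lb * 1) (cubic (d + 1) (evenPeriod t))) 0 × idx L (fine (Lb * 1) (cubic (d + 1) (evenPeriod t))) 0) => avgTow (QBlev L (fine (Lb * 1) (cubic (d + 1) (evenPeriod t)))) ((L : ℝ) ^ (d + 1)) (fun k => calGlev L (fine (Lb * 1) (cubic (d + 1) (evenPeriod t))) a ha k * Pmodel L (fine (Lb * 1) (cubic (d + 1)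 (evenPeriod t))) (V t x) k * calGlev L (fine (Lb * 1) (cubic (d + 1) (evenPeriod t))) a ha k) k q.1 q.2) * ((((unitCovB L (fine (Lb * 1) (cubic (d + 1) (evenPeriod t))) a ha k)⁻¹ * (((flucCov (reM (DelK (lev L k) (one_le_lev' L k) (fine (Lb * 1) (cubic (d + 1) (evenPeriod t))) a ha)) (Matrix.fromRows (reM (QB 1 Lb (cubic (d + 1) (evenPeriod t)))) (fun (t' : {x : Tor (fine (Lb * 1) (cubic (d + 1) (evenPeriod t))) × Fin (d + 1) // (∀ ν, ν < x.2 → ((rem 1 Lb (cubic (d + 1) (evenPeriod t)) x.1 ν : ℕ)) = 0) ∧ ((rem 1 Lb (cubic (d + 1) (evenPeriod t)) x.1 x.2 : ℕ)) + 1 < Lb}) (x : Tor (fine (Lb * 1) (cubic (d + 1) (evenPeriod t))) × Fin (d + 1)) => if x = (Function.Embedding.subtype (fun x : Tor (fine (Lb * 1) (cubic (d + 1) (evenPeriod t))) × Fin (d + 1) => (∀ ν, ν < x.2 → ((rem 1 Lb (cubic (d + 1) (evenPeriod t)) x.1 ν : ℕ)) = 0) ∧ ((rem 1 Lb (cubic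 (d + 1) (evenPeriod t)) x.1 x.2 : ℕ)) + 1 < Lb)) t' then (1 : ℝ) else 0))).map ((↑) : ℝ → ℂ)).submatrix (unitIdx L (fine (Lb * 1) (cubic (d + 1) (evenPeriod t)))) (unitIdx L (fine (Lb * 1) (cubic (d + 1) (evenPeriod t))))) * (unitCovB L (fine (Lb * 1) (cubic (d + 1) (evenPeriod t))) a ha k)⁻¹)) ⊗ₖ (((unitCovB L (fine (Lb * 1) (cubic (d + 1) (evenPeriod t))) a ha k)⁻¹ * (((flucCov (reM (DelK (lev L k) (one_le_lev' L k) (fine (Lb * 1) (cubic (d + 1) (evenPeriod t))) a ha)) (Matrix.fromRows (reM (QB 1 Lb (cubic (d + 1) (evenPeriod t)))) (fun (t' : {x : Tor (fine (Lb * 1) (cubic (d + 1) (evenPeriod t))) × Fin (d + 1) // (∀ ν, ν < x.2 → ((rem 1 Lb (cubic (d + 1) (evenPeriod t)) x.1 ν : ℕ)) = 0) ∧ ((rem 1 Lb (cubic (d + 1) (evenPeriod t)) x.1 x.2 : ℕ)) + 1 < Lb}) (x : Tor (fine (Lb * 1) (cubic (d + 1) (evenPeriod t))) × Fin (d + 1))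 => if x = (Function.Embedding.subtype (fun x : Tor (fine (Lb * 1) (cubic (d + 1) (evenPeriod t))) × Fin (d + 1) => (∀ ν, ν < x.2 → ((rem 1 Lb (cubic (d + 1) (evenPeriod t)) x.1 ν : ℕ)) = 0) ∧ ((rem 1 Lb (cubic (d + 1) (evenPeriod t)) x.1 x.2 : ℕ)) + 1 < Lb)) t' then (1 : ℝ) else 0))).map ((↑) : ℝ → ℂ)).submatrix (unitIdx L (fine (Lb * 1) (cubic (d + 1) (evenPeriod t)))) (unitIdx L (fine (Lb * 1) (cubic (d + 1) (evenPeriod t))))) * (unitCovB L (fine (Lb * 1) (cubic (d + 1) (evenPeriod t))) a ha k)⁻¹))) * ((Matrix.of fun (x : idx L (fine (Lb * 1) (cubic (d + 1) (evenPeriod t))) 0) (q : idx L (fine (Lb * 1) (cubic (d + 1) (evenPeriod t))) 0 × idx L (fine (Lb * 1) (cubic (d + 1) (evenPeriod t))) 0) => avgTow (QBlev L (fine (Lb * 1) (cubic (d + 1) (evenPeriod t)))) ((L : ℝ) ^ (d + 1)) (fun k => calGlev L (fine (Lb * 1) (cubic (d + 1) (evenPeriod t))) a ha k * Pmodel L (fine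 (Lb * 1) (cubic (d + 1) (evenPeriod t))) (V t x) k * calGlev L (fine (Lb * 1) (cubic (d + 1) (evenPeriod t))) a ha k) k q.1 q.2))ᴴ) ((unitIdx L (fine (Lb * 1) (cubic (d + 1) (evenPeriod t)))).symm (z, μ')) ((unitIdx L (fine (Lb * 1) (cubic (d + 1) (evenPeriod t)))).symm (0, ν'))).re) (Pinf k)) ∧
      Beta.LimitRate.UniformDecay Pinf μ ν C ((κ₁ / 4) / (((d + 1 : ℕ)) : ℝ)) ∧
      StepRate Pinf μ ν C' ((κ₁ / 4) / (((d + 1 : ℕ)) : ℝ)) (Real.sqrt (Real.sqrt ((L : ℝ)⁻¹))) ∧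
      (∃ K : KernelInputs (d + 1) Pinf, K.θ = Real.sqrt (Real.sqrt ((L : ℝ)⁻¹)) ∧ K.c₀ = betaPrime510 (d + 1) (C' / (1 - Real.sqrt (Real.sqrt ((L : ℝ)⁻¹)))) ((κ₁ / 4) / (((d + 1 : ℕ)) : ℝ)) ∧
        K.Pinf = limKernelOf Pinf ∧ K.μ = μ ∧ K.ν = ν) ∧
      (∀ k, |B12Beta.secondMoment (Pinf k) μ ν - B12Beta.secondMoment (limKernelOf Pinf) μ ν|
          ≤ betaPrime510 (d + 1) (C' / (1 - Real.sqrt (Real.sqrt ((L : ℝ)⁻¹)))) ((κ₁ / 4) / (((d + 1 : ℕ)) : ℝ)) * Real.sqrt (Real.sqrt ((L : ℝ)⁻¹)) ^ k) := by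
  have hL1 : (1 : ℝ) < L := by exact_mod_cast (lt_of_lt_of_le one_lt_two hL : 1 < L)
  have hρ0 : (0 : ℝ) ≤ (L : ℝ)⁻¹ := inv_nonneg.mpr (Nat.cast_nonneg _)
  have hρ1 : ((L : ℝ)⁻¹) < 1 := inv_lt_one_of_one_lt₀ hL1
  have hσ0 : 0 ≤ Real.sqrt ((L : ℝ)⁻¹) := Real.sqrt_nonneg _
  have hσ1 : Real.sqrt ((L : ℝ)⁻¹) < 1 := by
    rw [show (1 : ℝ) = Real.sqrt 1 from Real.sqrt_one.symm]
    exact Real.sqrt_lt_sqrt hρ0 hρ1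
  have hθL : Real.sqrt ((L : ℝ)⁻¹) ≤ Real.sqrt (Real.sqrt ((L : ℝ)⁻¹)) := by
    calc Real.sqrt ((L : ℝ)⁻¹) = Real.sqrt (Real.sqrt ((L : ℝ)⁻¹) ^ 2) := (Real.sqrt_sq hσ0).symm
      _ ≤ Real.sqrt (Real.sqrt ((L : ℝ)⁻¹)) := Real.sqrt_le_sqrt (by nlinarith)
  have hθ1 : Real.sqrt (Real.sqrt ((L : ℝ)⁻¹)) < 1 := by
    rw [show (1 : ℝ) = Real.sqrt 1 from Real.sqrt_one.symm]
    exact Real.sqrt_lt_sqrt hσ0 hσ1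
  have hθ0 : 0 ≤ Real.sqrt (Real.sqrt ((L : ℝ)⁻¹)) := Real.sqrt_nonneg _
  obtain ⟨κΓ, B, B', hκΓ, hB, hB', henv⟩ := almostNestedLegs_envelopes L a ha Lb hL α c₀ hα m
  obtain ⟨h1, h2⟩ := henv evenPeriod V A hVb hdir hA hdef hloc
  obtain ⟨κ₁, C, C', hκ₁, -, hC, hC', h⟩ := conv_oneLoop_loopCov_moving_of_ratio (L := L) (Lb := Lb) (a := a) (ha := ha) (s := evenPeriod) hL (by omega)
    tendsto_evenPeriod (a' := 1) one_pos hne hκΓ hθL hθ1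
  obtain ⟨Pinf, hP⟩ := h B B B' B' hB hB hB' hB'
    (fun t k => (Matrix.of fun (x : idx L (fine (Lb * 1) (cubic (d + 1) (evenPeriod t))) 0) (q : idx L (fine (Lb * 1) (cubic (d + 1) (evenPeriod t))) 0 × idx L (fine (Lb * 1) (cubic (d + 1) (evenPeriod t))) 0) => avgTow (QBlev L (fine (Lb * 1) (cubic (d + 1) (evenPeriod t)))) ((L : ℝ) ^ (d + 1)) (fun k => calGlev L (fine (Lb * 1) (cubic (d + 1) (evenPeriod t))) a ha k * Pmodel L (fine (Lb * 1) (cubic (d + 1) (evenPeriod t))) (V t x) k * calGlev L (fine (Lb * 1) (cubic (d + 1) (evenPeriod t))) a ha k) k q.1 q.2))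
    (fun t k => (Matrix.of fun (x : idx L (fine (Lb * 1) (cubic (d + 1) (evenPeriod t))) 0) (q : idx L (fine (Lb * 1) (cubic (d + 1) (evenPeriod t))) 0 × idx L (fine (Lb * 1) (cubic (d + 1) (evenPeriod t))) 0) => avgTow (QBlev L (fine (Lb * 1) (cubic (d + 1) (evenPeriod t)))) ((L : ℝ) ^ (d + 1)) (fun k => calGlev L (fine (Lb * 1) (cubic (d + 1) (evenPeriod t))) a ha k * Pmodel L (fine (Lb * 1) (cubic (d + 1) (evenPeriod t))) (V t x) k * calGlev L (fine (Lb * 1) (cubic (d + 1) (evenPeriod t))) a ha k) k q.1 q.2))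
    h1 h1 h2 h2 (fun k μ' l l' z u v => boundedLegs_tendsto L Lb a ha hd hα hVb k (fun z μ' μ₀ f w => hel z μ' k μ₀ f w) μ' l l' z u v)
    (fun k μ' l l' z u v => boundedLegs_tendsto L Lb a ha hd hα hVb k (fun z μ' μ₀ f w => hel z μ' k μ₀ f w) μ' l l' z u v)
  exact ⟨κ₁, B * B * C, (B' * B + B * B') * C + B * B * C', hκ₁, by positivity, by positivity, Pinf, hP⟩

end Summit.QuantumFields.BalabanUV.Beta.GAN24.AlmostNestedLoopEnd

end
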